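import Literature.Analysis.FluidPDE.NSLocalLerayFarFieldVorticityBypass
import Literature.Analysis.FluidPDE.NSBoundedHigherRegularityQuantProofs
import HarnessLib

/-!
# `localLeray_farField_vorticity_eq_zero_slab_holds` (and the global form): far-field backward uniqueness for the vorticity on a slab (Lemarié-Rieusset 2016, proof of Thm. 15.4, Steps 2–3)

Analysis/FluidPDE proof file (theorems only: no definition, no named fact, no `sorry`).  It composes
reductions that are already in the tree with the discharge of the quantitative higher-regularity
theorem for bounded distributional Navier–Stokes solutions, `NSBoundedHigherRegularityBounds_holds`
(`NSBoundedHigherRegularityQuantProofs.lean`; Seregin–Šverák 2009, §2 p. 8 = Serrin's interior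
regularity with constants, proved by the Serrin bootstrap `NSBootstrap*.lean`), which was the last
open hypothesis of each reduction used below.  No statement is changed; each `theorem X_holds : X`
turns the named fact `X` from literature debt into a theorem.
-/

namespace Literature.Analysis.FluidPDE

/-- **Steps 2–3 of Thm. 15.4 on a slab, proved**: `localLeray_farField_vorticity_eq_zero_slab` holds — the bypass of the `C¹` ESS leaf through the `C¹₂` Carleman chain (`localLeray_farField_vorticity_eq_zero_slab_of_higherRegularityBounds`, NSLocalLerayFarFieldVorticityBypass.lean) fed with `NSBoundedHigherRegularityBounds_holds`.  This is hypothesis V of `seregin_L3_blowup_mild_of_UC` (NSLocalLerayBackwardUniquenessUC.lean) on the line of `seregin_L3_blowup_mild`.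
[cite: LemarieRieusset2016, proof of Thm. 15.4, Steps 2–3 (PDF pp. 568–569)] -/
theorem localLeray_farField_vorticity_eq_zero_slab_holds : localLeray_farField_vorticity_eq_zero_slab :=
  localLeray_farField_vorticity_eq_zero_slab_of_higherRegularityBounds NSBoundedHigherRegularityBounds_holds

/-- **Steps 2–3 of Thm. 15.4 for global local Leray solutions, proved**: `localLeray_farField_vorticity_eq_zero` holds — the slab-to-global reduction `localLeray_farField_vorticity_eq_zero_of_slab` (NSLocalLerayBackwardUniquenessSlab.lean) fed with `localLeray_farField_vorticity_eq_zero_slab_holds` above.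
[cite: LemarieRieusset2016, proof of Thm. 15.4, Steps 2–3 (PDF pp. 568–569)] -/
theorem localLeray_farField_vorticity_eq_zero_holds : localLeray_farField_vorticity_eq_zero :=
  localLeray_farField_vorticity_eq_zero_of_slab localLeray_farField_vorticity_eq_zero_slab_holds

end Literature.Analysis.FluidPDE
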